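import Summits.QuantumFields.BalabanUV.T4Continuum.Support.RegionElectricGeneral
import Summits.QuantumFields.BalabanUV.T4Continuum.Support.RegionNormPairingTools

/-!
# T⁴ programme, spine node NE2 (U1a), sub-row Δ1 «NE2⁰-Dirichlet» — THE CORNER COUPLING OF THE ELECTRIC OPERATOR IS OF ORDER `n²`:
# `‖cornerC‖ ≤ (2 + 4d)·n²` on EVERY union of blocks, with the two one-sided form bounds

NE2 formalisation swarm `b2b-balaban-t4-ne2-formalise-*`, LEAF PROVER 07 (gen 10), supplier brick for the owner's located NEXT FRONT (regions
with re-entrant exterior contact, ruling R37 (e), journal 2026-08-20 l.≈22730) on top of leaf-02-g8's `Support/RegionElectricGeneral` (p240775: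
`electric_general : curlRᴴ·curlR + gradR·gradRᴴ = Σ_μ Wdir μ + cornerC`, `cornerC = diag(n²·cnt1 (b.2) b) − E·Eᴴ`, `cornerC = 0` under H1;
«its norm ≍ n² on that set is the successor's estimate»).  THIS FILE is that estimate, crude but level-explicit and region-free:

 * §1 `extFlux_le_nsq`: `extFlux A ≤ 4d·n²·‖A‖²` (the exterior flux is a part of the torus divergence energy of the zero extension, and
   `‖∂ᴴ‖² = ‖∂‖² ≤ 4d n²` by `RegionNormPairingTools.nsq_GradOp_mulVec_le`); `opNorm_extGrad_le` (`‖E‖ ≤ 2√d·n`), `opNorm_extGram_le`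
   (`‖E·Eᴴ‖ ≤ 4d·n²`); `cnt1_le_two`, `opNorm_ownCharge_le` (`‖diag(n²·cnt1)‖ ≤ 2n²`).
 * §2 **`opNorm_cornerC_le : ‖cornerC n M S‖ ≤ (2 + 4·d)·n²`** and the form bounds **`re_form_cornerC_le`** (`re⟨A, C A⟩ ≤ 2n²·‖A‖²`),
   **`neg_re_form_cornerC_le`** (`−4d·n²·‖A‖² ≤ re⟨A, C A⟩`) — every union `S`, every level `n`, no H1.
   (Numerically — this lineage's memo `t4/T4-EST-NE2-D1-REENTRANT.md` v1 — `‖cornerC‖ = n²` exactly on the one-hole complements and the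
   L-shape in d = 2; the constant `2 + 4d` here is a Cauchy–Schwarz bound, not sharp.)

HONEST FRAMING (T4-DAG p. 1).  Lattice calculus at MODEL level (`U = 1`, ONE region, finite torus); statements OURS ([folklore]); an ORDER
bound only — it does NOT make the coupling small against `Δ_loc` (both are of order n²) and proves nothing about the two-level laws on re-entrant
regions; W3 on general unions OPEN; Δ1 NOT closed; NE2 (U1a) NOT proved; spine PROVED 0/9 unchanged; NOT [B9] (3.16)/(3.23)–(3.27)/(3.42) as
printed; NOT infinite volume, NOT a mass gap, NOT the Clay problem.  HONEST DEPENDENCY: continuum YM on T⁴ ⇐ BetaPertH ∧ nine spine estimates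
(0/9 proved); BetaPertH ⇐ (D1) ∧ (D4) ∧ CAP+tail; G-an2-4 gates asym, D1 and NE2/3/4.  No `sorry`.
-/

noncomputable section

open scoped BigOperators ComplexConjugate Matrix Matrix.Norms.L2Operator
open Finset

namespace Summit.QuantumFields.BalabanUV.T4Continuum.RegionElectricCornerNorm

open Literature.MathematicalPhysics.QuantumFieldTheory.Balaban1983to89.B5Prop11Plancherel (Tor fine)
open Literature.MathematicalPhysics.QuantumFieldTheory.Balaban1983to89.B5Prop11Lower (nsq nsq_nonneg)
open Literature.MathematicalPhysics.QuantumFieldTheory.Balaban1983to89.B5Action121 (GradOp)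
open Literature.MathematicalPhysics.QuantumFieldTheory.Balaban1983to89.B5G183RateL2Op (opNorm_diagonal_le)
open Summit.QuantumFields.BalabanUV.T4Continuum
open Summit.QuantumFields.BalabanUV.T4Continuum.SubtypeCompression (ext nsq_ext)
open Summit.QuantumFields.BalabanUV.T4Continuum.RegionGaugeFixedVector (starReg gradR)
open Summit.QuantumFields.BalabanUV.T4Continuum.RegionGaffneyIdentity (extFlux extFlux_nonneg nsq_div_ext_eq)
open Summit.QuantumFields.BalabanUV.T4Continuum.RegionElectricSplitting (cnt1 cnt1_nonneg)
open Summit.QuantumFields.BalabanUV.T4Continuum.RegionElectricGeneral (extGrad cornerC nsq_extGrad_conjTranspose_mulVec form_cornerC)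
open Summit.QuantumFields.BalabanUV.T4Continuum.RegionNormPairingTools (nsq_GradOp_mulVec_le)
open Summit.QuantumFields.BalabanUV.T4Continuum.ScalarAveragedPropagator (opNorm_le_of_nsq_le_rect)
open Summit.QuantumFields.BalabanUV.T4Continuum.BalabanBlockPoincare (nsq_mulVec_le_rect)
open Summit.QuantumFields.BalabanUV.Beta.GAN24.DirichletBoxTrace (blockReg)

variable {d : ℕ}

section Region

variable (n : ℕ) [NeZero n] (M : Fin d → ℕ) [hM : ∀ μ, NeZero (M μ)] (S : Tor M → Prop) [DecidablePred S]

/-! ## §1 The exterior flux and the exterior-gradient block are of order `n` -/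

/-- `‖∂‖ ≤ 2√d·n` on the fine torus (operator form of `nsq_GradOp_mulVec_le`). [folklore] -/
theorem opNorm_GradOp_le : ‖GradOp (fine n M) (n : ℂ)‖ ≤ 2 * Real.sqrt d * n := by
  have h0 : 0 ≤ 2 * Real.sqrt d * n := by positivity
  refine opNorm_le_of_nsq_le_rect _ h0 fun g => ?_
  have h := nsq_GradOp_mulVec_le n M g
  calc nsq (GradOp (fine n M) (n : ℂ) *ᵥ g) ≤ 4 * d * (n : ℝ) ^ 2 * nsq g := h
    _ = (2 * Real.sqrt d * n) ^ 2 * nsq g := by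
        rw [mul_pow, mul_pow, Real.sq_sqrt (Nat.cast_nonneg d)]; ring

/-- the torus divergence energy of any bond field: `‖∂ᴴ v‖² ≤ 4d·n²·‖v‖²`. [folklore] -/
theorem nsq_GradOp_conjTranspose_mulVec_le (v : Tor (fine n M) × Fin d → ℂ) :
    nsq ((GradOp (fine n M) (n : ℂ))ᴴ *ᵥ v) ≤ 4 * d * (n : ℝ) ^ 2 * nsq v := by
  have h1 := nsq_mulVec_le_rect ((GradOp (fine n M) (n : ℂ))ᴴ) v
  have h2 : ‖(GradOp (fine n M) (n : ℂ))ᴴ‖ ≤ 2 * Real.sqrt d * n := by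
    rw [Matrix.l2_opNorm_conjTranspose]; exact opNorm_GradOp_le n M
  have h3 : ‖(GradOp (fine n M) (n : ℂ))ᴴ‖ ^ 2 ≤ (2 * Real.sqrt d * n) ^ 2 := pow_le_pow_left₀ (norm_nonneg _) h2 2
  have h4 : (2 * Real.sqrt d * (n : ℝ)) ^ 2 = 4 * d * (n : ℝ) ^ 2 := by
    rw [mul_pow, mul_pow, Real.sq_sqrt (Nat.cast_nonneg d)]; ring
  calc nsq ((GradOp (fine n M) (n : ℂ))ᴴ *ᵥ v) ≤ ‖(GradOp (fine n M) (n : ℂ))ᴴ‖ ^ 2 * nsq v := h1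
    _ ≤ (2 * Real.sqrt d * n) ^ 2 * nsq v := mul_le_mul_of_nonneg_right h3 (nsq_nonneg v)
    _ = 4 * d * (n : ℝ) ^ 2 * nsq v := by rw [h4]

/-- **THE EXTERIOR FLUX IS OF ORDER `n²`**: `extFlux A ≤ 4d·n²·‖A‖²` on every union of blocks. [folklore] -/
theorem extFlux_le_nsq (A : {b // starReg n M S b} → ℂ) : extFlux n M S A ≤ 4 * d * (n : ℝ) ^ 2 * nsq A := by
  have h1 := nsq_div_ext_eq n M S A
  have h2 := nsq_GradOp_conjTranspose_mulVec_le n M (ext (starReg n M S) A)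
  rw [nsq_ext] at h2
  have h3 := nsq_nonneg ((gradR n M S)ᴴ *ᵥ A)
  linarith

/-- `‖Eᴴ‖ ≤ 2√d·n`. [folklore] -/
theorem opNorm_extGrad_conjTranspose_le : ‖(extGrad n M S)ᴴ‖ ≤ 2 * Real.sqrt d * n := by
  have h0 : 0 ≤ 2 * Real.sqrt d * n := by positivity
  refine opNorm_le_of_nsq_le_rect _ h0 fun A => ?_
  rw [nsq_extGrad_conjTranspose_mulVec]
  calc extFlux n M S A ≤ 4 * d * (n : ℝ) ^ 2 * nsq A := extFlux_le_nsq n M S A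
    _ = (2 * Real.sqrt d * n) ^ 2 * nsq A := by rw [mul_pow, mul_pow, Real.sq_sqrt (Nat.cast_nonneg d)]; ring

/-- `‖E‖ ≤ 2√d·n`. [folklore] -/
theorem opNorm_extGrad_le : ‖extGrad n M S‖ ≤ 2 * Real.sqrt d * n := by
  rw [← Matrix.l2_opNorm_conjTranspose]; exact opNorm_extGrad_conjTranspose_le n M S

/-- `‖E·Eᴴ‖ ≤ 4d·n²`. [folklore] -/
theorem opNorm_extGram_le : ‖extGrad n M S * (extGrad n M S)ᴴ‖ ≤ 4 * d * (n : ℝ) ^ 2 := by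
  have h1 := opNorm_extGrad_le n M S
  have h2 := opNorm_extGrad_conjTranspose_le n M S
  have h0 : 0 ≤ 2 * Real.sqrt d * n := by positivity
  calc ‖extGrad n M S * (extGrad n M S)ᴴ‖ ≤ ‖extGrad n M S‖ * ‖(extGrad n M S)ᴴ‖ := Matrix.l2_opNorm_mul _ _
    _ ≤ (2 * Real.sqrt d * n) * (2 * Real.sqrt d * n) := mul_le_mul h1 h2 (norm_nonneg _) h0
    _ = 4 * d * (n : ℝ) ^ 2 := by
        have : Real.sqrt d * Real.sqrt d = d := Real.mul_self_sqrt (Nat.cast_nonneg d)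
        calc (2 * Real.sqrt d * n) * (2 * Real.sqrt d * n) = 4 * (Real.sqrt d * Real.sqrt d) * ((n : ℝ) * n) := by ring
          _ = 4 * d * (n : ℝ) ^ 2 := by rw [this, sq]

/-- the per-direction charge is at most `2`. [folklore] -/
theorem cnt1_le_two (μ : Fin d) (b : Tor (fine n M) × Fin d) : cnt1 n M S μ b ≤ 2 := by
  unfold cnt1
  have h1 : (if starReg n M S (b.1 + Literature.MathematicalPhysics.QuantumFieldTheory.Balaban1983to89.B5Prop11Plancherel.unitVec (fine n M) μ, b.2)
      then (0 : ℝ) else 1) ≤ 1 := by split_ifs <;> norm_num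
  have h2 : (if starReg n M S (b.1 - Literature.MathematicalPhysics.QuantumFieldTheory.Balaban1983to89.B5Prop11Plancherel.unitVec (fine n M) μ, b.2)
      then (0 : ℝ) else 1) ≤ 1 := by split_ifs <;> norm_num
  linarith

/-- `‖diag(n²·cnt1 (b.2) b)‖ ≤ 2n²` (the own-direction zero-extension charges). [folklore] -/
theorem opNorm_ownCharge_le :
    ‖Matrix.diagonal (fun b : {b // starReg n M S b} => (((n : ℝ) ^ 2 * cnt1 n M S b.1.2 b.1 : ℝ) : ℂ))‖ ≤ 2 * (n : ℝ) ^ 2 := by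
  refine opNorm_diagonal_le _ (by positivity) fun b => ?_
  rw [Complex.norm_real, Real.norm_of_nonneg (mul_nonneg (sq_nonneg _) (cnt1_nonneg n M S b.1.2 b.1))]
  have := cnt1_le_two n M S b.1.2 b.1
  nlinarith [sq_nonneg (n : ℝ)]

/-! ## §2 The corner coupling is of order `n²` -/

/-- **`‖cornerC‖ ≤ (2 + 4d)·n²`** on EVERY union of blocks and at every level (no H1). [folklore] -/
theorem opNorm_cornerC_le : ‖cornerC n M S‖ ≤ (2 + 4 * d) * (n : ℝ) ^ 2 := by
  unfold cornerC
  calc ‖Matrix.diagonal (fun b : {b // starReg n M S b} => (((n : ℝ) ^ 2 * cnt1 n M S b.1.2 b.1 : ℝ) : ℂ))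
          - extGrad n M S * (extGrad n M S)ᴴ‖
      ≤ ‖Matrix.diagonal (fun b : {b // starReg n M S b} => (((n : ℝ) ^ 2 * cnt1 n M S b.1.2 b.1 : ℝ) : ℂ))‖
          + ‖extGrad n M S * (extGrad n M S)ᴴ‖ := norm_sub_le _ _
    _ ≤ 2 * (n : ℝ) ^ 2 + 4 * d * (n : ℝ) ^ 2 := add_le_add (opNorm_ownCharge_le n M S) (opNorm_extGram_le n M S)
    _ = (2 + 4 * d) * (n : ℝ) ^ 2 := by ring

/-- **UPPER FORM BOUND**: `re⟨A, C A⟩ ≤ 2n²·‖A‖²` (the charges; the exterior Gram block is nonnegative). [folklore] -/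
theorem re_form_cornerC_le (A : {b // starReg n M S b} → ℂ) :
    (star A ⬝ᵥ (cornerC n M S *ᵥ A)).re ≤ 2 * (n : ℝ) ^ 2 * nsq A := by
  rw [form_cornerC, Complex.ofReal_re]
  have h1 : ∑ b : {b // starReg n M S b}, cnt1 n M S b.1.2 b.1 * ‖A b‖ ^ 2 ≤ ∑ b : {b // starReg n M S b}, 2 * ‖A b‖ ^ 2 :=
    sum_le_sum fun b _ => mul_le_mul_of_nonneg_right (cnt1_le_two n M S b.1.2 b.1) (sq_nonneg _)
  rw [← mul_sum] at h1
  have h2 := extFlux_nonneg n M S A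
  have h3 : (n : ℝ) ^ 2 * ∑ b : {b // starReg n M S b}, cnt1 n M S b.1.2 b.1 * ‖A b‖ ^ 2 ≤ (n : ℝ) ^ 2 * (2 * nsq A) :=
    mul_le_mul_of_nonneg_left h1 (sq_nonneg _)
  unfold nsq at h3 ⊢
  linarith

/-- **LOWER FORM BOUND**: `−4d·n²·‖A‖² ≤ re⟨A, C A⟩` (the charges are nonnegative; the exterior flux is at most `4d n²‖A‖²`). [folklore] -/
theorem neg_re_form_cornerC_le (A : {b // starReg n M S b} → ℂ) :
    -(4 * d * (n : ℝ) ^ 2 * nsq A) ≤ (star A ⬝ᵥ (cornerC n M S *ᵥ A)).re := by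
  rw [form_cornerC, Complex.ofReal_re]
  have h1 : 0 ≤ ∑ b : {b // starReg n M S b}, cnt1 n M S b.1.2 b.1 * ‖A b‖ ^ 2 :=
    sum_nonneg fun b _ => mul_nonneg (cnt1_nonneg n M S b.1.2 b.1) (sq_nonneg _)
  have h2 := extFlux_le_nsq n M S A
  have h3 : 0 ≤ (n : ℝ) ^ 2 * ∑ b : {b // starReg n M S b}, cnt1 n M S b.1.2 b.1 * ‖A b‖ ^ 2 := mul_nonneg (sq_nonneg _) h1
  linarith

end Region

end Summit.QuantumFields.BalabanUV.T4Continuum.RegionElectricCornerNorm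

end
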